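import Mathlib

/-!
# FrustratedLawDichotomy · two-shell rigidity — ORTHONORMAL FRAMES and the tetrahedral coefficient comparison
# (beneath `R = CoarseCappedRigidity` of `FrustratedLawDichotomyTwoShellRigidityCells`; crux `AperiodicFrustratedLawGap`, stmt-27623)

Theses-free toolkit (pure Mathlib) for the cell lemmas of the coarse capped rigidity piece `R` (lens-5 g30 split
`R ⟸ Extraction ∧ TetraCell ∧ OctaCell ∧ FrameAssembly`, glue `coarseCappedRigidityAt_of_cells`):

* `exists_unit_orthogonal_two`, `exists_unit_carrier`, `gramSchmidt_triple` — total Gram–Schmidt for a triple in a real inner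
  product space of dimension three: `a = ‖a‖ f₀`, `b = β f₀ + γ f₁`, `c = δ f₀ + ε f₁ + ζ f₂` in SOME orthonormal frame, `γ, ζ ≥ 0`;
* `inner_frame`, `norm_sq_frame`, `norm_frame_le` — coordinates in an orthonormal frame;
* `exists_linearIsometry_of_frames` — two orthonormal frames are matched by a linear isometry (`OrthonormalBasis.repr`);
* `tetra_coeff_bounds` (+ the small windows it is assembled from) — the real-arithmetic comparison of the Gram–Schmidt
  coefficients of a near-regular tetrahedron (norms in `[1, 1+t]`, mutual distances in `[1/(1+t), (1+t)²]`, `t ≤ 1/100`) with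
  the regular one: every vertex within `11·t` (worst vertex `(3.1² + 7.8² + 6.4²)·t² = 111.41·t² ≤ 121·t²`).
Consumed by `FrustratedLawDichotomyTwoShellRigidityTetraCell` (`TetraCellAt 11` for both kissing patterns).  No `sorry`, no defs.
-/

noncomputable section

namespace Summit.AtomisticToContinuum.Crystallization.Theorems.FrustratedLawDichotomyTwoShellRigidityFrames

open scoped RealInnerProductSpace

/-! ## Orthonormal frames in a real inner product space of dimension three -/

variable {V : Type*} [NormedAddCommGroup V] [InnerProductSpace ℝ V]

/-- In `ℝ³` there is a unit vector orthogonal to any two given vectors. [folklore] -/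
theorem exists_unit_orthogonal_two [FiniteDimensional ℝ V] (hV : Module.finrank ℝ V = 3) (p q : V) :
    ∃ n : V, ‖n‖ = 1 ∧ ⟪n, p⟫ = 0 ∧ ⟪n, q⟫ = 0 := by
  classical
  set K : Submodule ℝ V := Submodule.span ℝ (↑({p, q} : Finset V) : Set V) with hK
  have hfin : Module.finrank ℝ K ≤ 2 :=
    (finrank_span_finset_le_card ({p, q} : Finset V)).trans (Finset.card_le_two)
  have hKtop : K ≠ ⊤ := by
    intro htop
    have h3 : Module.finrank ℝ K = 3 := by
      rw [htop, finrank_top, hV]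
    omega
  have hKbot : Kᗮ ≠ ⊥ := fun h => hKtop ((Submodule.orthogonal_eq_bot_iff).1 h)
  obtain ⟨m, hm, hm0⟩ := Submodule.exists_mem_ne_zero_of_ne_bot hKbot
  have hp : p ∈ K := Submodule.subset_span (by simp)
  have hq : q ∈ K := Submodule.subset_span (by simp)
  have hmn : ‖m‖ ≠ 0 := norm_ne_zero_iff.2 hm0
  refine ⟨‖m‖⁻¹ • m, ?_, ?_, ?_⟩
  · rw [norm_smul, norm_inv, norm_norm, inv_mul_cancel₀ hmn]
  · rw [real_inner_smul_left, Submodule.inner_left_of_mem_orthogonal hp hm, mul_zero]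
  · rw [real_inner_smul_left, Submodule.inner_left_of_mem_orthogonal hq hm, mul_zero]

/-- A unit vector orthogonal to `f₀` carrying `g`: if `g ⊥ f₀` then `g = ‖g‖ • f₁` for some unit `f₁ ⊥ f₀` (normalise `g`, or take
any unit normal when `g = 0`). [folklore] -/
theorem exists_unit_carrier [FiniteDimensional ℝ V] (hV : Module.finrank ℝ V = 3) {f₀ e g : V} (h0 : ⟪f₀, g⟫ = 0)
    (he : ⟪e, g⟫ = 0) : ∃ f₁ : V, ‖f₁‖ = 1 ∧ ⟪f₀, f₁⟫ = 0 ∧ ⟪e, f₁⟫ = 0 ∧ g = ‖g‖ • f₁ := by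
  by_cases hg : g = 0
  · obtain ⟨n, hn, hn0, hne⟩ := exists_unit_orthogonal_two hV f₀ e
    refine ⟨n, hn, ?_, ?_, by simp [hg]⟩
    · rw [real_inner_comm, hn0]
    · rw [real_inner_comm, hne]
  · have hgn : ‖g‖ ≠ 0 := norm_ne_zero_iff.2 hg
    refine ⟨‖g‖⁻¹ • g, ?_, ?_, ?_, ?_⟩
    · rw [norm_smul, norm_inv, norm_norm, inv_mul_cancel₀ hgn]
    · rw [real_inner_smul_right, h0, mul_zero]
    · rw [real_inner_smul_right, he, mul_zero]
    · rw [smul_smul, mul_inv_cancel₀ hgn, one_smul]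

/-- **Gram–Schmidt for a triple** (total form): every `a, b, c ∈ ℝ³` expand in SOME orthonormal frame as `a = ‖a‖ f₀`,
`b = β f₀ + γ f₁`, `c = δ f₀ + ε f₁ + ζ f₂` with `γ, ζ ≥ 0`. [folklore] -/
theorem gramSchmidt_triple [FiniteDimensional ℝ V] (hV : Module.finrank ℝ V = 3) (a b c : V) :
    ∃ (f₀ f₁ f₂ : V) (β γ δ ε ζ : ℝ), ‖f₀‖ = 1 ∧ ‖f₁‖ = 1 ∧ ‖f₂‖ = 1 ∧ ⟪f₀, f₁⟫ = 0 ∧ ⟪f₀, f₂⟫ = 0 ∧ ⟪f₁, f₂⟫ = 0 ∧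
      a = ‖a‖ • f₀ ∧ b = β • f₀ + γ • f₁ ∧ c = δ • f₀ + ε • f₁ + ζ • f₂ ∧ 0 ≤ γ ∧ 0 ≤ ζ := by
  -- step 0: `a = ‖a‖ f₀`
  obtain ⟨f₀, hf₀, -, -, ha⟩ : ∃ f₀ : V, ‖f₀‖ = 1 ∧ ⟪(0 : V), f₀⟫ = 0 ∧ ⟪(0 : V), f₀⟫ = 0 ∧ a = ‖a‖ • f₀ :=
    exists_unit_carrier hV (inner_zero_left a) (inner_zero_left a)
  have h00 : ⟪f₀, f₀⟫ = 1 := by rw [real_inner_self_eq_norm_sq, hf₀, one_pow]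
  -- step 1: `b - β f₀ = γ f₁`
  set β : ℝ := ⟪b, f₀⟫ with hβ
  have hg1 : ⟪f₀, b - β • f₀⟫ = 0 := by
    rw [inner_sub_right, real_inner_smul_right, h00, mul_one, real_inner_comm, hβ, sub_self]
  obtain ⟨f₁, hf₁, h01, -, hb⟩ := exists_unit_carrier hV hg1 hg1
  have h11 : ⟪f₁, f₁⟫ = 1 := by rw [real_inner_self_eq_norm_sq, hf₁, one_pow]
  have h10 : ⟪f₁, f₀⟫ = 0 := by rw [real_inner_comm, h01]
  -- step 2: `c - δ f₀ - ε f₁ = ζ f₂`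
  set δ : ℝ := ⟪c, f₀⟫ with hδ
  set ε : ℝ := ⟪c, f₁⟫ with hε
  have hg2 : ⟪f₀, c - δ • f₀ - ε • f₁⟫ = 0 := by
    rw [inner_sub_right, inner_sub_right, real_inner_smul_right, real_inner_smul_right, h00, h01, mul_one,
      mul_zero, sub_zero, real_inner_comm, hδ, sub_self]
  have hg2' : ⟪f₁, c - δ • f₀ - ε • f₁⟫ = 0 := by
    rw [inner_sub_right, inner_sub_right, real_inner_smul_right, real_inner_smul_right, h10, h11, mul_one,
      mul_zero, sub_zero, real_inner_comm, hε, sub_self]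
  obtain ⟨f₂, hf₂, h02, h12, hc⟩ := exists_unit_carrier hV hg2 hg2'
  refine ⟨f₀, f₁, f₂, β, ‖b - β • f₀‖, δ, ε, ‖c - δ • f₀ - ε • f₁‖, hf₀, hf₁, hf₂, h01, h02, h12, ha, ?_, ?_,
    norm_nonneg _, norm_nonneg _⟩
  · rw [← hb]; abel
  · rw [← hc]; abel

/-- Inner products in an orthonormal frame: `⟪p f₀ + q f₁ + r f₂, p' f₀ + q' f₁ + r' f₂⟫ = pp' + qq' + rr'`. [folklore] -/
theorem inner_frame {f₀ f₁ f₂ : V} (h0 : ‖f₀‖ = 1) (h1 : ‖f₁‖ = 1) (h2 : ‖f₂‖ = 1) (h01 : ⟪f₀, f₁⟫ = 0)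
    (h02 : ⟪f₀, f₂⟫ = 0) (h12 : ⟪f₁, f₂⟫ = 0) (p q r p' q' r' : ℝ) :
    ⟪p • f₀ + q • f₁ + r • f₂, p' • f₀ + q' • f₁ + r' • f₂⟫ = p * p' + q * q' + r * r' := by
  have h00 : ⟪f₀, f₀⟫ = 1 := by rw [real_inner_self_eq_norm_sq, h0, one_pow]
  have h11 : ⟪f₁, f₁⟫ = 1 := by rw [real_inner_self_eq_norm_sq, h1, one_pow]
  have h22 : ⟪f₂, f₂⟫ = 1 := by rw [real_inner_self_eq_norm_sq, h2, one_pow]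
  have h10 : ⟪f₁, f₀⟫ = 0 := by rw [real_inner_comm, h01]
  have h20 : ⟪f₂, f₀⟫ = 0 := by rw [real_inner_comm, h02]
  have h21 : ⟪f₂, f₁⟫ = 0 := by rw [real_inner_comm, h12]
  simp only [inner_add_left, inner_add_right, real_inner_smul_left, real_inner_smul_right, h00, h11, h22, h01, h02,
    h12, h10, h20, h21]
  ring

/-- Norms in an orthonormal frame: `‖p f₀ + q f₁ + r f₂‖² = p² + q² + r²`. [folklore] -/
theorem norm_sq_frame {f₀ f₁ f₂ : V} (h0 : ‖f₀‖ = 1) (h1 : ‖f₁‖ = 1) (h2 : ‖f₂‖ = 1) (h01 : ⟪f₀, f₁⟫ = 0)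
    (h02 : ⟪f₀, f₂⟫ = 0) (h12 : ⟪f₁, f₂⟫ = 0) (p q r : ℝ) :
    ‖p • f₀ + q • f₁ + r • f₂‖ ^ 2 = p ^ 2 + q ^ 2 + r ^ 2 := by
  rw [← real_inner_self_eq_norm_sq, inner_frame h0 h1 h2 h01 h02 h12]; ring

/-- A frame bound: `p² + q² + r² ≤ C²`, `0 ≤ C` ⟹ `‖p f₀ + q f₁ + r f₂‖ ≤ C`. [folklore] -/
theorem norm_frame_le {f₀ f₁ f₂ : V} (h0 : ‖f₀‖ = 1) (h1 : ‖f₁‖ = 1) (h2 : ‖f₂‖ = 1) (h01 : ⟪f₀, f₁⟫ = 0)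
    (h02 : ⟪f₀, f₂⟫ = 0) (h12 : ⟪f₁, f₂⟫ = 0) {p q r C : ℝ} (hC : 0 ≤ C) (h : p ^ 2 + q ^ 2 + r ^ 2 ≤ C ^ 2) :
    ‖p • f₀ + q • f₁ + r • f₂‖ ≤ C := by
  have hsq : ‖p • f₀ + q • f₁ + r • f₂‖ ^ 2 ≤ C ^ 2 := by rw [norm_sq_frame h0 h1 h2 h01 h02 h12]; exact h
  exact (sq_le_sq₀ (norm_nonneg _) hC).1 hsq

/-- Two orthonormal frames of `ℝ³` are matched by a linear isometry. [folklore] -/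
theorem exists_linearIsometry_of_frames [FiniteDimensional ℝ V] (hV : Module.finrank ℝ V = 3) {e₀ e₁ e₂ f₀ f₁ f₂ : V} (he0 : ‖e₀‖ = 1) (he1 : ‖e₁‖ = 1) (he2 : ‖e₂‖ = 1)
    (he01 : ⟪e₀, e₁⟫ = 0) (he02 : ⟪e₀, e₂⟫ = 0) (he12 : ⟪e₁, e₂⟫ = 0) (hf0 : ‖f₀‖ = 1) (hf1 : ‖f₁‖ = 1)
    (hf2 : ‖f₂‖ = 1) (hf01 : ⟪f₀, f₁⟫ = 0) (hf02 : ⟪f₀, f₂⟫ = 0) (hf12 : ⟪f₁, f₂⟫ = 0) :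
    ∃ A : V →ₗᵢ[ℝ] V, A e₀ = f₀ ∧ A e₁ = f₁ ∧ A e₂ = f₂ := by
  classical
  have hon : ∀ {g₀ g₁ g₂ : V}, ‖g₀‖ = 1 → ‖g₁‖ = 1 → ‖g₂‖ = 1 → ⟪g₀, g₁⟫ = 0 → ⟪g₀, g₂⟫ = 0 → ⟪g₁, g₂⟫ = 0 →
      Orthonormal ℝ ![g₀, g₁, g₂] := by
    intro g₀ g₁ g₂ h0 h1 h2 h01 h02 h12
    have h10 : ⟪g₁, g₀⟫ = 0 := by rw [real_inner_comm, h01]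
    have h20 : ⟪g₂, g₀⟫ = 0 := by rw [real_inner_comm, h02]
    have h21 : ⟪g₂, g₁⟫ = 0 := by rw [real_inner_comm, h12]
    rw [orthonormal_iff_ite]
    intro i j
    fin_cases i <;> fin_cases j <;> simp [h0, h1, h2, h01, h02, h12, h10, h20, h21]
  have hone := hon he0 he1 he2 he01 he02 he12
  have honf := hon hf0 hf1 hf2 hf01 hf02 hf12
  have hcard : Fintype.card (Fin 3) = Module.finrank ℝ V := by rw [Fintype.card_fin, hV]
  let be : OrthonormalBasis (Fin 3) ℝ V := OrthonormalBasis.mk hone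
    (by rw [hone.linearIndependent.span_eq_top_of_card_eq_finrank hcard])
  let bf : OrthonormalBasis (Fin 3) ℝ V := OrthonormalBasis.mk honf
    (by rw [honf.linearIndependent.span_eq_top_of_card_eq_finrank hcard])
  have hbe : ∀ k, be k = ![e₀, e₁, e₂] k := fun k => by rw [OrthonormalBasis.coe_mk]
  have hbf : ∀ k, bf k = ![f₀, f₁, f₂] k := fun k => by rw [OrthonormalBasis.coe_mk]
  have key : ∀ k, (be.repr.trans bf.repr.symm) (be k) = bf k := fun k => by
    rw [LinearIsometryEquiv.trans_apply, be.repr_self, bf.repr_symm_single]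
  refine ⟨(be.repr.trans bf.repr.symm).toLinearIsometry, ?_, ?_, ?_⟩
  · have := key 0; rw [hbe, hbf] at this; simpa using this
  · have := key 1; rw [hbe, hbf] at this; simpa using this
  · have := key 2; rw [hbe, hbf] at this; simpa using this

/-! ## The coefficient comparison (pure real arithmetic, split into small windows) -/

/-- `t² ≤ t/100` for `0 ≤ t ≤ 1/100`. [folklore] -/
theorem sq_le_div_hundred {t : ℝ} (ht0 : 0 ≤ t) (ht1 : t ≤ 1 / 100) : t ^ 2 ≤ t / 100 := by nlinarith

/-- Norm window squared: `1 ≤ n ≤ 1 + t` ⟹ `1 ≤ n² ≤ 1 + 2.01 t` (`0 ≤ t ≤ 1/100`). [folklore] -/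
theorem norm_sq_window {t n : ℝ} (ht0 : 0 ≤ t) (ht1 : t ≤ 1 / 100) (h1 : 1 ≤ n) (h2 : n ≤ 1 + t) :
    1 ≤ n ^ 2 ∧ n ^ 2 ≤ 1 + 201 / 100 * t := by
  have := sq_le_div_hundred ht0 ht1
  constructor <;> nlinarith

/-- Distance window squared: `1/(1+t) ≤ D ≤ (1+t)²` ⟹ `1 − 2t ≤ D² ≤ 1 + 4.07 t` (`0 ≤ t ≤ 1/100`). [folklore] -/
theorem dist_sq_window {t D : ℝ} (ht0 : 0 ≤ t) (ht1 : t ≤ 1 / 100) (h1 : 1 / (1 + t) ≤ D) (h2 : D ≤ (1 + t) ^ 2) :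
    1 - 2 * t ≤ D ^ 2 ∧ D ^ 2 ≤ 1 + 407 / 100 * t := by
  have h1t : 0 < 1 + t := by linarith
  rw [div_le_iff₀ h1t] at h1
  have hD0 : 0 < D := by
    by_contra h
    push Not at h
    nlinarith
  constructor
  · have h3 : 1 ≤ (D * (1 + t)) ^ 2 := by nlinarith
    by_contra h
    push Not at h
    have h4 : 0 < (1 - 2 * t - D ^ 2) * (1 + t) ^ 2 := mul_pos (by linarith) (by positivity)
    nlinarith
  · have h4 : D ^ 2 ≤ ((1 + t) ^ 2) ^ 2 := pow_le_pow_left₀ hD0.le h2 2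
    have ht2 := sq_le_div_hundred ht0 ht1
    have ht3 : t ^ 3 ≤ t / 10000 := by nlinarith
    have ht4 : t ^ 4 ≤ t / 1000000 := by nlinarith
    nlinarith

/-- First frame coordinate: `na·x ∈ [1/2 − 2.1t, 1/2 + 3.1t]`, `na ∈ [1, 1+t]` ⟹ `x ∈ [1/2 − 2.6t, 1/2 + 3.1t]`. [folklore] -/
theorem first_coord_window {t na x : ℝ} (ht0 : 0 ≤ t) (ht1 : t ≤ 1 / 100) (hna1 : 1 ≤ na) (hna2 : na ≤ 1 + t)
    (h1 : 1 / 2 - 21 / 10 * t ≤ na * x) (h2 : na * x ≤ 1 / 2 + 31 / 10 * t) :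
    1 / 2 - 26 / 10 * t ≤ x ∧ x ≤ 1 / 2 + 31 / 10 * t := by
  have hx0 : 0 < x := by
    by_contra h
    push Not at h
    nlinarith
  constructor
  · by_contra h
    push Not at h
    have h3 : 0 < (1 / 2 - 26 / 10 * t - x) * (1 + t) := mul_pos (by linarith) (by linarith)
    nlinarith
  · nlinarith

/-- Product of two first coordinates: `x, x' ∈ [1/2 − 2.6t, 1/2 + 3.1t]` ⟹ `x·x' ∈ [1/4 − 2.6t, 1/4 + 3.2t]`. [folklore] -/
theorem coord_mul_window {t x x' : ℝ} (ht0 : 0 ≤ t) (ht1 : t ≤ 1 / 100) (h1 : 1 / 2 - 26 / 10 * t ≤ x)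
    (h2 : x ≤ 1 / 2 + 31 / 10 * t) (h1' : 1 / 2 - 26 / 10 * t ≤ x') (h2' : x' ≤ 1 / 2 + 31 / 10 * t) :
    1 / 4 - 26 / 10 * t ≤ x * x' ∧ x * x' ≤ 1 / 4 + 32 / 10 * t := by
  have := sq_le_div_hundred ht0 ht1
  have hl : 0 ≤ (x - (1 / 2 - 26 / 10 * t)) * (x' - (1 / 2 - 26 / 10 * t)) := mul_nonneg (by linarith) (by linarith)
  have hu : 0 ≤ (1 / 2 + 31 / 10 * t - x) * (1 / 2 + 31 / 10 * t - x') := mul_nonneg (by linarith) (by linarith)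
  have hm : 0 ≤ (x - (1 / 2 - 26 / 10 * t)) * (1 / 2 + 31 / 10 * t - x') := mul_nonneg (by linarith) (by linarith)
  constructor <;> nlinarith

/-- A square root comparison: `0 < m ≤ y + y₀`, `y² − y₀² ≤ e`, `0 ≤ e` ⟹ `y − y₀ ≤ e/m`. [folklore] -/
theorem sub_le_of_sq_sub_le {y y₀ m e : ℝ} (hm : 0 < m) (hs : m ≤ y + y₀) (h : y ^ 2 - y₀ ^ 2 ≤ e) (he : 0 ≤ e) :
    y - y₀ ≤ e / m := by
  rw [le_div_iff₀ hm]
  by_cases hy : y - y₀ ≤ 0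
  · nlinarith
  · push Not at hy
    nlinarith [mul_le_mul_of_nonneg_left hs hy.le]

/-- The symmetric comparison: `0 < m ≤ y + y₀`, `−e ≤ y² − y₀²`, `0 ≤ e` ⟹ `−(e/m) ≤ y − y₀`. [folklore] -/
theorem neg_le_sub_of_le_sq_sub {y y₀ m e : ℝ} (hm : 0 < m) (hs : m ≤ y + y₀) (h : -e ≤ y ^ 2 - y₀ ^ 2) (he : 0 ≤ e) :
    -(e / m) ≤ y - y₀ := by
  have := sub_le_of_sq_sub_le (y := y₀) (y₀ := y) hm (by linarith) (by linarith) he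
  linarith

/-- A lower square root: `0 ≤ y`, `L² ≤ y²`, `0 ≤ L` ⟹ `L ≤ y`. [folklore] -/
theorem le_of_sq_le_sq_nonneg {y L : ℝ} (hy : 0 ≤ y) (hL : 0 ≤ L) (h : L ^ 2 ≤ y ^ 2) : L ≤ y :=
  (sq_le_sq₀ hL hy).1 h

/-- Product window: `0 ≤ p ≤ P`, `|e| ≤ E` ⟹ `|p·e| ≤ P·E`. [folklore] -/
theorem mul_window {p P e E : ℝ} (hp0 : 0 ≤ p) (hpP : p ≤ P) (he1 : -E ≤ e) (he2 : e ≤ E) :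
    -(P * E) ≤ p * e ∧ p * e ≤ P * E := by
  have hE : 0 ≤ E := by linarith
  have h1 : 0 ≤ p * (E - e) := mul_nonneg hp0 (by linarith)
  have h2 : 0 ≤ p * (e + E) := mul_nonneg hp0 (by linarith)
  have h3 : 0 ≤ (P - p) * E := mul_nonneg (by linarith) hE
  constructor <;> nlinarith

/-- **Coefficient comparison for the near-regular tetrahedron.**  Gram–Schmidt coefficients of a data triple with norms in
`[1, 1+t]` and mutual distances in `[1/(1+t), (1+t)²]` (`0 < t ≤ 1/100`) versus those of a unit reference triple with mutual
distances `1` (`β₀ = δ₀ = 1/2`, `γ₀² = 3/4`, `γ₀ε₀ = 1/4`, `ζ₀² = 2/3`): every vertex deviates by at most `11·t` in the frame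
coordinates (`|β − 1/2| ≤ 3.1t`, `|γ − γ₀| ≤ 2.8t`, `|δ − 1/2| ≤ 3.1t`, `|ε − ε₀| ≤ 7.8t`, `|ζ − ζ₀| ≤ 6.4t`; worst vertex
`111.41·t² ≤ 121·t²`). [folklore] -/
theorem tetra_coeff_bounds {t na nb nc Dab Dac Dbc β γ δ ε ζ γ₀ ε₀ ζ₀ : ℝ} (ht0 : 0 < t) (ht1 : t ≤ 1 / 100)
    (hna1 : 1 ≤ na) (hna2 : na ≤ 1 + t) (hnb1 : 1 ≤ nb) (hnb2 : nb ≤ 1 + t) (hnc1 : 1 ≤ nc) (hnc2 : nc ≤ 1 + t)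
    (hab1 : 1 / (1 + t) ≤ Dab) (hab2 : Dab ≤ (1 + t) ^ 2) (hac1 : 1 / (1 + t) ≤ Dac) (hac2 : Dac ≤ (1 + t) ^ 2)
    (hbc1 : 1 / (1 + t) ≤ Dbc) (hbc2 : Dbc ≤ (1 + t) ^ 2)
    (hβ : na * β = (na ^ 2 + nb ^ 2 - Dab ^ 2) / 2) (hγ0 : 0 ≤ γ) (hγ : nb ^ 2 = β ^ 2 + γ ^ 2)
    (hδ : na * δ = (na ^ 2 + nc ^ 2 - Dac ^ 2) / 2) (hε : β * δ + γ * ε = (nb ^ 2 + nc ^ 2 - Dbc ^ 2) / 2)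
    (hζ0 : 0 ≤ ζ) (hζ : nc ^ 2 = δ ^ 2 + ε ^ 2 + ζ ^ 2)
    (hr1 : 0 ≤ γ₀) (hr2 : γ₀ ^ 2 = 3 / 4) (hr3 : γ₀ * ε₀ = 1 / 4) (hr4 : 0 ≤ ζ₀) (hr5 : ζ₀ ^ 2 = 2 / 3) :
    (na - 1) ^ 2 + (0 : ℝ) ^ 2 + (0 : ℝ) ^ 2 ≤ (11 * t) ^ 2 ∧
      (β - 1 / 2) ^ 2 + (γ - γ₀) ^ 2 + (0 : ℝ) ^ 2 ≤ (11 * t) ^ 2 ∧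
        (δ - 1 / 2) ^ 2 + (ε - ε₀) ^ 2 + (ζ - ζ₀) ^ 2 ≤ (11 * t) ^ 2 := by
  have ht := ht0.le
  have ht2 := sq_le_div_hundred ht ht1
  -- windows of the Gram data
  obtain ⟨hna4, hna3⟩ := norm_sq_window ht ht1 hna1 hna2
  obtain ⟨hnb4, hnb3⟩ := norm_sq_window ht ht1 hnb1 hnb2
  obtain ⟨hnc4, hnc3⟩ := norm_sq_window ht ht1 hnc1 hnc2
  obtain ⟨hab3, hab4⟩ := dist_sq_window ht ht1 hab1 hab2
  obtain ⟨hac3, hac4⟩ := dist_sq_window ht ht1 hac1 hac2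
  obtain ⟨hbc3, hbc4⟩ := dist_sq_window ht ht1 hbc1 hbc2
  have hPab1 : 1 / 2 - 21 / 10 * t ≤ na * β := by rw [hβ]; linarith only [hna4, hnb4, hab4, ht]
  have hPab2 : na * β ≤ 1 / 2 + 31 / 10 * t := by rw [hβ]; linarith only [hna3, hnb3, hab3, ht]
  have hPac1 : 1 / 2 - 21 / 10 * t ≤ na * δ := by rw [hδ]; linarith only [hna4, hnc4, hac4, ht]
  have hPac2 : na * δ ≤ 1 / 2 + 31 / 10 * t := by rw [hδ]; linarith only [hna3, hnc3, hac3, ht]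
  have hPbc1 : 1 / 2 - 21 / 10 * t ≤ β * δ + γ * ε := by rw [hε]; linarith only [hnb4, hnc4, hbc4, ht]
  have hPbc2 : β * δ + γ * ε ≤ 1 / 2 + 31 / 10 * t := by rw [hε]; linarith only [hnb3, hnc3, hbc3, ht]
  -- first coordinates `β`, `δ`
  obtain ⟨hβ1, hβ2⟩ := first_coord_window ht ht1 hna1 hna2 hPab1 hPab2
  obtain ⟨hδ1, hδ2⟩ := first_coord_window ht ht1 hna1 hna2 hPac1 hPac2
  obtain ⟨hβ3, hβ4⟩ := coord_mul_window ht ht1 hβ1 hβ2 hβ1 hβ2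
  obtain ⟨hδ3, hδ4⟩ := coord_mul_window ht ht1 hδ1 hδ2 hδ1 hδ2
  obtain ⟨hβδ1, hβδ2⟩ := coord_mul_window ht ht1 hβ1 hβ2 hδ1 hδ2
  -- second coordinate `γ`
  have hγ1 : -(32 / 10 * t) ≤ γ ^ 2 - γ₀ ^ 2 := by linarith only [hγ, hnb4, hβ4, hr2, ht]
  have hγ2 : γ ^ 2 - γ₀ ^ 2 ≤ 47 / 10 * t := by linarith only [hγ, hnb3, hβ3, hr2, ht]
  have hγ3 : 847 / 1000 ≤ γ :=
    le_of_sq_le_sq_nonneg hγ0 (by norm_num) (by norm_num; linarith only [hγ1, hr2, ht1])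
  have hγ₀1 : 866 / 1000 ≤ γ₀ := le_of_sq_le_sq_nonneg hr1 (by norm_num) (by norm_num; linarith only [hr2])
  have hγ₀2 : γ₀ ≤ 8661 / 10000 := (sq_le_sq₀ hr1 (by norm_num)).1 (by norm_num; linarith only [hr2])
  have hs1 : (1713 / 1000 : ℝ) ≤ γ + γ₀ := by linarith only [hγ3, hγ₀1]
  have hγup : γ - γ₀ ≤ 28 / 10 * t := by
    have := sub_le_of_sq_sub_le (by norm_num) hs1 hγ2 (by linarith only [ht])
    linarith only [this, ht]
  have hγlo : -(28 / 10 * t) ≤ γ - γ₀ := by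
    have := neg_le_sub_of_le_sq_sub (by norm_num) hs1 hγ1 (by linarith only [ht])
    linarith only [this, ht]
  -- the coefficient `ε`
  have hε₀0 : 0 < ε₀ := by
    by_contra h
    push Not at h
    have := mul_nonpos_of_nonneg_of_nonpos hr1 h
    linarith only [this, hr3]
  have hε₀1 : 2886 / 10000 ≤ ε₀ := by
    have := mul_le_mul_of_nonneg_left hγ₀2 hε₀0.le
    linarith only [this, hr3, mul_comm γ₀ ε₀]
  have hε₀2 : ε₀ ≤ 2887 / 10000 := by
    have := mul_le_mul_of_nonneg_left hγ₀1 hε₀0.le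
    linarith only [this, hr3, mul_comm γ₀ ε₀]
  have hγε1 : 1 / 4 - 53 / 10 * t ≤ γ * ε := by linarith only [hPbc1, hβδ2, ht]
  have hγε2 : γ * ε ≤ 1 / 4 + 57 / 10 * t := by linarith only [hPbc2, hβδ1, ht]
  have hkey : γ * (ε - ε₀) = (γ * ε - 1 / 4) - ε₀ * (γ - γ₀) := by linear_combination -hr3
  obtain ⟨hε₀e2, hε₀e1⟩ := mul_window hε₀0.le hε₀2 hγlo hγup
  have hγe1 : γ * (ε - ε₀) ≤ 651 / 100 * t := by rw [hkey]; linarith only [hγε2, hε₀e2, ht]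
  have hγe2 : -(611 / 100 * t) ≤ γ * (ε - ε₀) := by rw [hkey]; linarith only [hγε1, hε₀e1, ht]
  have hεup : ε - ε₀ ≤ 78 / 10 * t := by
    by_contra H
    push Not at H
    have h1 : 0 < (ε - ε₀ - 78 / 10 * t) * γ := mul_pos (by linarith only [H]) (by linarith only [hγ3])
    have h2 : 0 ≤ (γ - 847 / 1000) * t := mul_nonneg (by linarith only [hγ3]) ht
    linarith only [h1, h2, hγe1, ht0]
  have hεlo : -(78 / 10 * t) ≤ ε - ε₀ := by
    by_contra H
    push Not at H
    have h1 : 0 < (ε₀ - ε - 78 / 10 * t) * γ := mul_pos (by linarith only [H]) (by linarith only [hγ3])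
    have h2 : 0 ≤ (γ - 847 / 1000) * t := mul_nonneg (by linarith only [hγ3]) ht
    linarith only [h1, h2, hγe2, ht0]
  -- `ε² − ε₀²`
  have hε₀sq : ε₀ ^ 2 = 1 / 12 := by
    have h : γ₀ ^ 2 * ε₀ ^ 2 = 1 / 16 := by rw [← mul_pow, hr3]; norm_num
    rw [hr2] at h
    linarith only [h]
  have hesq : (ε - ε₀) ^ 2 ≤ (78 / 10 * t) ^ 2 := sq_le_sq' hεlo hεup
  have hid : ε ^ 2 - ε₀ ^ 2 = 2 * (ε₀ * (ε - ε₀)) + (ε - ε₀) ^ 2 := by ring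
  obtain ⟨hpe1, hpe2⟩ := mul_window hε₀0.le hε₀2 hεlo hεup
  have hεsq1 : ε ^ 2 - ε₀ ^ 2 ≤ 52 / 10 * t := by rw [hid]; linarith only [hpe2, hesq, ht2, ht]
  have hεsq2 : -(52 / 10 * t) ≤ ε ^ 2 - ε₀ ^ 2 := by
    rw [hid]; linarith only [hpe1, sq_nonneg (ε - ε₀), ht]
  -- third coordinate `ζ`
  have hζ1 : -(84 / 10 * t) ≤ ζ ^ 2 - ζ₀ ^ 2 := by linarith only [hζ, hnc4, hδ4, hεsq1, hε₀sq, hr5, ht]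
  have hζ2 : ζ ^ 2 - ζ₀ ^ 2 ≤ 99 / 10 * t := by linarith only [hζ, hnc3, hδ3, hεsq2, hε₀sq, hr5, ht]
  have hζ3 : 763 / 1000 ≤ ζ :=
    le_of_sq_le_sq_nonneg hζ0 (by norm_num) (by norm_num; linarith only [hζ1, hr5, ht1])
  have hζ₀1 : 8164 / 10000 ≤ ζ₀ := le_of_sq_le_sq_nonneg hr4 (by norm_num) (by norm_num; linarith only [hr5])
  have hs2 : (15794 / 10000 : ℝ) ≤ ζ + ζ₀ := by linarith only [hζ3, hζ₀1]
  have hζup : ζ - ζ₀ ≤ 64 / 10 * t := by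
    have := sub_le_of_sq_sub_le (by norm_num) hs2 hζ2 (by linarith only [ht])
    linarith only [this, ht]
  have hζlo : -(64 / 10 * t) ≤ ζ - ζ₀ := by
    have := neg_le_sub_of_le_sq_sub (by norm_num) hs2 hζ1 (by linarith only [ht])
    linarith only [this, ht]
  -- assembly
  have hA : (na - 1) ^ 2 ≤ t ^ 2 := sq_le_sq' (by linarith only [hna1, ht]) (by linarith only [hna2])
  have hB : (β - 1 / 2) ^ 2 ≤ (31 / 10 * t) ^ 2 := sq_le_sq' (by linarith only [hβ1, ht]) (by linarith only [hβ2])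
  have hC : (γ - γ₀) ^ 2 ≤ (28 / 10 * t) ^ 2 := sq_le_sq' hγlo hγup
  have hD : (δ - 1 / 2) ^ 2 ≤ (31 / 10 * t) ^ 2 := sq_le_sq' (by linarith only [hδ1, ht]) (by linarith only [hδ2])
  have hF : (ζ - ζ₀) ^ 2 ≤ (64 / 10 * t) ^ 2 := sq_le_sq' hζlo hζup
  have ht22 := sq_nonneg t
  refine ⟨by linarith only [hA, ht22], by linarith only [hB, hC, ht22], by linarith only [hD, hesq, hF, ht22]⟩

end Summit.AtomisticToContinuum.Crystallization.Theorems.FrustratedLawDichotomyTwoShellRigidityFrames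

end
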